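import Literature.NumberTheory.Automorphic.GodementJacquetLemma610Bounded   -- ★ `setIntegral_isIntegralMatrix_eq`, `normAbs_det_of_mem_glIntDet`, `inv_natCast_pow_cpow`, `isUniformizingElement_of_normAbs_eq`, `card_cosets_glIntDet_le_pow`
import Literature.NumberTheory.Automorphic.TateLocalZetaShells             -- ★ `exists_normAbs_eq_inv` (a uniformiser `|ϖ| = q⁻¹`)
import Literature.LinearAlgebra.Subspace.GaussianBinomialCount             -- ★ `card_subspaces_fin_eq_qBinomial` (`#{Y ≤ 𝓀ⁿ : dim Y = d} = [n d]_q`)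
import HarnessLib

/-!
# K2 ∕ E5 «TamagawaUnitary» — `K2E5GL2UnramifiedLocalZeta`: the unramified local zeta integral of `GL₂` (trivial representation)
# `∫_{GL₂(F)} 1_{M₂(𝒪)}(x) |det x|_F^s dμ(x) = μ(GL₂(𝒪)) · (1 − q^{−s})⁻¹ (1 − q^{1−s})⁻¹`, `re s > 1`

Cell `hodgecm-mathlib` (Track B «K2-LIT»), engine E5, item h413 = `stmt-HodgeConjecture-24833`; helper for socket G4-loc SPLIT (K2E5-plan DEALS #8 (e),
2026-09-03T23:12:18Z: `Theorems/K2E5QuatLocalStdZetaSplit.lean` reduces to this file along a splitting datum `(D_{h,v})^× ≃ GL₂(L⁺_v)`); THEOREMS ONLY,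
`--supports stmt-HodgeConjecture-24833 --as helper`; author K2E5-p16 (g0).  Everything is assembled from ★ tree results BY NAME (the pattern of ★
`GodementJacquetLemma610Bounded.gjLocalZeta_indicator_intMatrices_eq_of_norm_le`, specialised to the trivial representation, where no Satake parameter is needed):

* §1 `card_transversalIndex_two` — for `n = 2` the degrees `D_i = #(K t_i K ∕ K) = #{Y ≤ 𝓀² : dim Y = 2 − i}` are `1, q + 1, 1` (★ `bijective_transversalIndex_span`,
  ★ `card_subspaces_fin_eq_qBinomial`); `mk_card_cosets_glIntDet_two_mul_eq_one` — TAMAGAWA's identity (★ `mk_heckeDetEigenvalue_mul_heckePolynomial_eq_one`,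
  Shimura 3.21) at the TRIVIAL representation of `GL₂(F)`: `(∑_m #(Δ_m K∕K) X^m) · (1 − X)(1 − qX) = 1` in `L⟦X⟧` (`K = GL₂(𝒪)`, `Δ_m = {x integral : |det x| = |ϖ|^m}`);
  `card_cosets_glIntDet_two` — hence `#(Δ_m K∕K) = ∑_{a ≤ m} q^a` (Shimura Thm. 3.24 (7): `deg T(p^k) = 1 + p + ⋯ + p^k`) and the geometric bound
  `#(Δ_m K∕K) ≤ (q∕(q−1)) q^m` (`card_cosets_glIntDet_two_le`).
* §2 **`integral_indicator_isIntegralMatrix_normAbs_det_cpow_two`** — for a non-archimedean local field `F` (`q = #𝓀_F`), a left-invariant measure `μ` on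
  `GL₂(F)` with `μ(K) < ∞` and `re s > 1`: `1_{M₂(𝒪)}(x) |det x|^s` is integrable and `∫ 1_{M₂(𝒪)}(x) |det x|^s dμ = μ(K) · ((1 − q^{−s})(1 − q^{1−s}))⁻¹` —
  Godement–Jacquet's unramified computation (Lemma 6.10) for the trivial representation of `GL₂`: unfold over the left cosets `yK ⊆ M₂(𝒪)`
  (★ `setIntegral_isIntegralMatrix_eq`; `|det| = q^{−m}` on `Δ_m`, ★ `normAbs_det_of_mem_glIntDet`) and sum `∑_m #(Δ_m K∕K) q^{−ms}` analytically (★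
  `tsum_eq_inv_eval_of_mk_mul_eq_one` of `HeckeSeriesConvergence` at `P = (1 − X)(1 − qX)`, radius `q^{−1}`, i.e. `re s > 1` — sharp).
The module of `D_h` being `|Nrd|²`, the quaternionic consumer evaluates this at `2s`: `Z_v(1_{Λ_v}, s) = ρ^D_v · ζ_v(2s) ζ_v(2s − 1)` (`K2E5QuatLocalStdZetaSplit`).
(★ `HeckeCosetCountGL` has the general-`n` count `∑_m #(Δ_m K∕K) X^m = ∏_{i<n}(1 − q^i X)⁻¹`; it is not imported because it is not in the farm's build closure
on 2026-09-03 — the `n = 2` case is re-derived here in 30 lines from the built ★ `TamagawaHeckeSeries`.)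

MATHEMATICS: [GodementJacquet1972, Lemma 6.10]; [Macdonald1995, Ch. V (4.6)]; [ShimuraIATAF1971, Thm. 3.21 and Thm. 3.24 (7), p. 83 (`∑ deg T(m) m^{−s} = ζ(s)ζ(s−1)`)];
[VignerasLNM800, Ch. II §4 Lemme 4.6 (the local zeta factor of `M(2, K_v)`), Ch. III §2].

HONEST LABEL: HC_CM is proved only modulo the 7 printed citations (2 remaining named inputs: hLiu418 = stmt-HodgeConjecture-24832,
h413 = stmt-HodgeConjecture-24833) until rung 0 closes; this file closes NO socket and discharges nothing.

References: [GodementJacquet1972] R. Godement, H. Jacquet, *Zeta functions of simple algebras*, LNM 260 (1972), Lemma 6.10 · [Macdonald1995] I. G. Macdonald,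
*Symmetric functions and Hall polynomials*, 2nd ed. (1995), Ch. V (4.6) · [ShimuraIATAF1971] G. Shimura (1971), Thm. 3.21, Thm. 3.24 (7) · [VignerasLNM800]
M.-F. Vignéras, LNM 800 (1980), Ch. II §4.
-/

set_option autoImplicit false
set_option linter.dupNamespace false

noncomputable section

namespace Summit.HodgeConjecture.HodgeConjecture.Cruxes.H413.K2E5GL2UnramifiedLocalZeta

open scoped MatrixGroups NNReal Polynomial
open MeasureTheory ValuativeRel Literature.NumberTheory.Automorphic
open Literature.NumberTheory.GaloisRepresentations.IsNonarchimedeanLocalField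
open Literature.LinearAlgebra.Subspace Literature.Combinatorics.Enumerative

variable {F : Type*} [Field F] [ValuativeRel F]

/-! ## §1 Tamagawa's identity for the trivial representation of `GL₂` and the coset count `1 + q + ⋯ + q^m` -/

/-- **The degrees of the `GL₂` Hecke operators**: `#(K t_i K ∕ K) = #TransversalIndex 2 F i = #{Y ≤ 𝓀² : dim Y = 2 − i} = [2 choose 2−i]_q`, i.e. `1, q+1, 1`
for `i = 0, 1, 2` (★ `bijective_transversalIndex_span`, ★ `card_subspaces_fin_eq_qBinomial`). [cite: ShimuraIATAF1971, Thm. 3.24 (7) (deg T(p) = p + 1)] -/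
theorem card_transversalIndex_two [Finite 𝓀[F]] (i : ℕ) :
    (Fintype.card (TransversalIndex 2 F i) : ℤ) = qBinomial (Nat.card 𝓀[F] : ℤ) 2 (2 - i) := by
  haveI : Fintype 𝓀[F] := Fintype.ofFinite _
  rw [← card_subspaces_fin_eq_qBinomial, ← Nat.card_eq_fintype_card]
  exact congrArg _ (Nat.card_eq_of_bijective _ (bijective_transversalIndex_span (n := 2) (F := F) i))

/-- The three values: `D_0 = 1`, `D_1 = q + 1`, `D_2 = 1`. [cite: ShimuraIATAF1971, Thm. 3.24 (7)] -/
theorem card_transversalIndex_two_eq [Finite 𝓀[F]] (L : Type*) [Field L] :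
    (Fintype.card (TransversalIndex 2 F 0) : L) = 1 ∧ (Fintype.card (TransversalIndex 2 F 1) : L) = Nat.card 𝓀[F] + 1 ∧
      (Fintype.card (TransversalIndex 2 F 2) : L) = 1 := by
  have h0 := card_transversalIndex_two (F := F) 0
  have h1 := card_transversalIndex_two (F := F) 1
  have h2 := card_transversalIndex_two (F := F) 2
  simp only [Nat.sub_zero, qBinomial_self, show 2 - 1 = 1 from rfl, Nat.sub_self, qBinomial_zero_right] at h0 h1 h2
  rw [show (2 : ℕ) = 1 + 1 from rfl, show (1 : ℕ) = 0 + 1 from rfl, qBinomial_succ_succ, qBinomial_self, qBinomial_zero_right, pow_one, mul_one] at h1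
  have e0 : Fintype.card (TransversalIndex 2 F 0) = 1 := by exact_mod_cast h0
  have e2 : Fintype.card (TransversalIndex 2 F 2) = 1 := by exact_mod_cast h2
  have e1 : Fintype.card (TransversalIndex 2 F 1) = Nat.card 𝓀[F] + 1 := by exact_mod_cast h1
  refine ⟨by rw [e0, Nat.cast_one], by rw [e1]; push_cast; ring, by rw [e2, Nat.cast_one]⟩

/-- **Tamagawa's identity for the trivial representation of `GL₂(F)`** (Shimura Thm. 3.21 at `ρ = 1`, where `T_i` acts by its degree `D_i` and `T(ϖ^m)` by the count
`N_m = #(Δ_m K ∕ K)`): `(∑_m N_m X^m) · ((1 − X)(1 − qX)) = 1` in `L⟦X⟧` — the Hecke polynomial `1 − (q+1)X + qX²` of the trivial representation factorised.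
(★ `mk_heckeDetEigenvalue_mul_heckePolynomial_eq_one` with the eigenvalues read off ★ `heckeOperator_apply_eq_sum` ∕ `bijOn_heckeTransversal` ∕ `heckeDetOperator_apply_eq_sum`.)
[cite: ShimuraIATAF1971, Theorem 3.21; p. 83] [cite: Macdonald1995, Ch. V (4.6)] -/
theorem mk_card_cosets_glIntDet_two_mul_eq_one [Finite 𝓀[F]] {ϖ : F} (hϖ : IsUniformizingElement ϖ) (L : Type*) [Field L] :
    PowerSeries.mk (fun m => ((finite_cosets_glIntDet (n := 2) hϖ m).toFinset.card : L)) *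
      (((1 - Polynomial.X) * (1 - Polynomial.C (Nat.card 𝓀[F] : L) * Polynomial.X) : L[X]) : PowerSeries L) = 1 := by
  set ρ := Representation.trivial L (GL (Fin 2) F) L with hρ
  have hv : (1 : L) ∈ ρ.fixedPoints (glInt 2 F) := by
    rw [Representation.mem_fixedPoints]; intro g _; rfl
  have hτ : ∀ i ≤ 2, heckeOperator ρ (glInt 2 F) (heckeDiag 2 (Units.mk0 ϖ hϖ.ne_zero) i) 1 =
      (Fintype.card (TransversalIndex 2 F i) : L) • (1 : L) := by
    intro i hi
    rw [heckeOperator_apply_eq_sum _ (glInt 2 F) _ _ (bijOn_heckeTransversal hϖ hi) hv, sum_heckeTransversal hϖ]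
    simp only [hρ, Representation.trivial_apply]
    rw [Finset.sum_const, Finset.card_univ, nsmul_eq_mul, mul_one, smul_eq_mul, mul_one]
  have hr : ∀ m, heckeDetOperator ρ ϖ m 1 = ((finite_cosets_glIntDet (n := 2) hϖ m).toFinset.card : L) • (1 : L) := by
    intro m
    rw [heckeDetOperator_apply_eq_sum _ m (finite_cosets_glIntDet hϖ m)]
    simp only [hρ, Representation.trivial_apply]
    rw [Finset.sum_const, nsmul_eq_mul, mul_one, smul_eq_mul, mul_one]
  have key := mk_heckeDetEigenvalue_mul_heckePolynomial_eq_one ρ hϖ hv one_ne_zero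
    (τ := fun i => (Fintype.card (TransversalIndex 2 F i) : L)) hτ hr
  obtain ⟨c0, c1, c2⟩ := card_transversalIndex_two_eq (F := F) L
  -- the Hecke polynomial of the trivial representation of `GL₂`: `1 − (q+1) X + q X² = (1 − X)(1 − qX)`
  have hpoly : (∑ i ∈ Finset.range (2 + 1), Polynomial.C ((-1 : L) ^ i * (Nat.card 𝓀[F] : L) ^ i.choose 2 *
      (Fintype.card (TransversalIndex 2 F i) : L)) * Polynomial.X ^ i : L[X]) =
      (1 - Polynomial.X) * (1 - Polynomial.C (Nat.card 𝓀[F] : L) * Polynomial.X) := by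
    have hc02 : Nat.choose 0 2 = 0 := rfl
    have hc12 : Nat.choose 1 2 = 0 := rfl
    have hc22 : Nat.choose 2 2 = 1 := rfl
    simp only [Finset.sum_range_succ, Finset.sum_range_zero, zero_add, c0, c1, c2, hc02, hc12, hc22,
      pow_zero, pow_one, mul_one, map_one, map_mul, map_neg, map_add, map_pow]
    simp only [map_natCast]
    ring
  rw [hpoly] at key
  exact key

/-- `(∑_m (∑_{a≤m} q^a) X^m) · (1 − X)(1 − qX) = 1`: the product of the two geometric series `∑ X^m` and `∑ q^m X^m`. [folklore] -/
theorem mk_geom_sum_mul_eq_one (L : Type*) [Field L] (q : L) :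
    PowerSeries.mk (fun m => ∑ a ∈ Finset.range (m + 1), q ^ a) *
      (((1 - Polynomial.X) * (1 - Polynomial.C q * Polynomial.X) : L[X]) : PowerSeries L) = 1 := by
  have h1 : PowerSeries.mk (1 : ℕ → L) * (1 - PowerSeries.X) = 1 := PowerSeries.mk_one_mul_one_sub_eq_one L
  have h2 : PowerSeries.mk (fun m : ℕ => q ^ m) * (1 - PowerSeries.C q * PowerSeries.X) = 1 := by
    have h := congrArg (PowerSeries.rescale q) (PowerSeries.mk_one_mul_one_sub_eq_one L)
    rw [map_mul, map_sub, map_one, PowerSeries.rescale_X, PowerSeries.rescale_mk] at h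
    simpa using h
  have hprod : PowerSeries.mk (fun m => ∑ a ∈ Finset.range (m + 1), q ^ a) = PowerSeries.mk (1 : ℕ → L) * PowerSeries.mk (fun m : ℕ => q ^ m) := by
    ext m
    rw [PowerSeries.coeff_mk, PowerSeries.coeff_mul, ← Finset.Nat.sum_antidiagonal_swap, Finset.Nat.sum_antidiagonal_eq_sum_range_succ_mk]
    refine Finset.sum_congr rfl fun k _ => ?_
    simp only [Prod.swap, PowerSeries.coeff_mk, Pi.one_apply, one_mul]
  rw [hprod, Polynomial.coe_mul, Polynomial.coe_sub, Polynomial.coe_sub, Polynomial.coe_one, Polynomial.coe_X, Polynomial.coe_mul, Polynomial.coe_C,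
    Polynomial.coe_X]
  calc PowerSeries.mk (1 : ℕ → L) * PowerSeries.mk (fun m : ℕ => q ^ m) * ((1 - PowerSeries.X) * (1 - PowerSeries.C q * PowerSeries.X))
      = (PowerSeries.mk (1 : ℕ → L) * (1 - PowerSeries.X)) * (PowerSeries.mk (fun m : ℕ => q ^ m) * (1 - PowerSeries.C q * PowerSeries.X)) := by ring
    _ = 1 := by rw [h1, h2, one_mul]

/-- **`#(Δ_m GL₂(𝒪) ∕ GL₂(𝒪)) = ∑_{a ≤ m} q^a`** (`q = #𝓀`): the number of left cosets of `K = GL₂(𝒪)` in the integral invertible matrices of determinant valuation `m`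
(both sides invert the same unit `(1 − X)(1 − qX)` of `L⟦X⟧`). [cite: ShimuraIATAF1971, Thm. 3.24 (7) (deg T(p^k) = 1 + p + ⋯ + p^k)] [cite: Macdonald1995, Ch. V (4.6)] -/
theorem card_cosets_glIntDet_two [Finite 𝓀[F]] {ϖ : F} (hϖ : IsUniformizingElement ϖ) (L : Type*) [Field L] (m : ℕ) :
    ((finite_cosets_glIntDet (n := 2) hϖ m).toFinset.card : L) = ∑ a ∈ Finset.range (m + 1), (Nat.card 𝓀[F] : L) ^ a := by
  set P : PowerSeries L := (((1 - Polynomial.X) * (1 - Polynomial.C (Nat.card 𝓀[F] : L) * Polynomial.X) : L[X]) : PowerSeries L) with hP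
  have hA := mk_card_cosets_glIntDet_two_mul_eq_one hϖ L
  have hB := mk_geom_sum_mul_eq_one L (Nat.card 𝓀[F] : L)
  rw [← hP] at hA hB
  have hAB : PowerSeries.mk (fun m => ((finite_cosets_glIntDet (n := 2) hϖ m).toFinset.card : L)) =
      PowerSeries.mk (fun m => ∑ a ∈ Finset.range (m + 1), (Nat.card 𝓀[F] : L) ^ a) := by
    calc PowerSeries.mk (fun m => ((finite_cosets_glIntDet (n := 2) hϖ m).toFinset.card : L))
        = PowerSeries.mk (fun m => ((finite_cosets_glIntDet (n := 2) hϖ m).toFinset.card : L)) *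
            (P * PowerSeries.mk (fun m => ∑ a ∈ Finset.range (m + 1), (Nat.card 𝓀[F] : L) ^ a)) := by rw [mul_comm P, hB, mul_one]
      _ = PowerSeries.mk (fun m => ∑ a ∈ Finset.range (m + 1), (Nat.card 𝓀[F] : L) ^ a) := by rw [← mul_assoc, hA, one_mul]
  have h := congrArg (PowerSeries.coeff m) hAB
  rwa [PowerSeries.coeff_mk, PowerSeries.coeff_mk] at h

/-- **Geometric bound** `#(Δ_m K ∕ K) ≤ (q ∕ (q − 1)) · q^m` (`∑_{a≤m} q^a = (q^{m+1} − 1)∕(q − 1)`, `q ≥ 2`). [folklore] -/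
theorem card_cosets_glIntDet_two_le [Finite 𝓀[F]] {ϖ : F} (hϖ : IsUniformizingElement ϖ) (m : ℕ) :
    ((finite_cosets_glIntDet (n := 2) hϖ m).toFinset.card : ℝ) ≤
      ((Nat.card 𝓀[F] : ℝ) / ((Nat.card 𝓀[F] : ℝ) - 1)) * (Nat.card 𝓀[F] : ℝ) ^ m := by
  have hq : (1 : ℝ) < Nat.card 𝓀[F] := by exact_mod_cast (Finite.one_lt_card : 1 < Nat.card 𝓀[F])
  have hq1 : (0 : ℝ) < (Nat.card 𝓀[F] : ℝ) - 1 := sub_pos.mpr hq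
  rw [card_cosets_glIntDet_two hϖ ℝ m, div_mul_eq_mul_div, le_div_iff₀ hq1, geom_sum_mul, ← pow_succ']
  linarith [pow_pos (lt_trans zero_lt_one hq) (m + 1)]

/-! ## §2 The unramified local zeta integral of `GL₂(F)` for the trivial representation -/

section Local

variable [TopologicalSpace F] [IsNonarchimedeanLocalField F] [MeasurableSpace (GL (Fin 2) F)] [BorelSpace (GL (Fin 2) F)]

/-- **GODEMENT–JACQUET'S UNRAMIFIED COMPUTATION FOR THE TRIVIAL REPRESENTATION OF `GL₂`.**  Let `F` be a non-archimedean local field with `q` elements in its residue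
field, `μ` a left-invariant measure on `GL₂(F)` finite on `K = GL₂(𝒪)`, and `re s > 1`.  Then `x ↦ 1_{M₂(𝒪)}(x) |det x|_F^s` is `μ`-integrable and
`∫_{GL₂(F)} 1_{M₂(𝒪)}(x) |det x|_F^s dμ(x) = μ(K) · ((1 − q^{−s})(1 − q^{1−s}))⁻¹ = μ(K) ζ_F(s) ζ_F(s − 1)`.
Proof: unfold over the left cosets `yK ⊆ M₂(𝒪) ∩ GL₂(F) = ⊔_m Δ_m` (★ `setIntegral_isIntegralMatrix_eq`; `|det| = q^{−m}` on `Δ_m`), count `#(Δ_m K∕K) = ∑_{a≤m} q^a ≤ (q∕(q−1)) q^m`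
(§1), and sum the Hecke series at `X = q^{−s}` (★ `tsum_eq_inv_eval_of_mk_mul_eq_one`, `‖q^{−s}‖ · q < 1 ⟺ re s > 1`).
[cite: GodementJacquet1972, Lemma 6.10] [cite: Macdonald1995, Ch. V (4.6)] [cite: ShimuraIATAF1971, p. 83 (∑ deg T(m) m^{−s} = ζ(s)ζ(s−1))] [cite: VignerasLNM800, Ch. II §4 Lemme 4.6] -/
theorem integral_indicator_isIntegralMatrix_normAbs_det_cpow_two (μG : Measure (GL (Fin 2) F)) [μG.IsMulLeftInvariant]
    (hμK : μG (glInt 2 F : Set (GL (Fin 2) F)) < ⊤) (s : ℂ) (hs : 1 < s.re) :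
    Integrable ({y : GL (Fin 2) F | IsIntegralMatrix (y : Matrix (Fin 2) (Fin 2) F)}.indicator
        fun y => ((((normAbs F ((Matrix.GeneralLinearGroup.det y : Fˣ) : F)) : ℝ≥0) : ℝ) : ℂ) ^ s) μG ∧
      ∫ x, {y : GL (Fin 2) F | IsIntegralMatrix (y : Matrix (Fin 2) (Fin 2) F)}.indicator
          (fun y => ((((normAbs F ((Matrix.GeneralLinearGroup.det y : Fˣ) : F)) : ℝ≥0) : ℝ) : ℂ) ^ s) x ∂μG =
        ((μG (glInt 2 F : Set (GL (Fin 2) F))).toReal : ℂ) *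
          ((1 - (Nat.card 𝓀[F] : ℂ) ^ (-s))⁻¹ * (1 - (Nat.card 𝓀[F] : ℂ) ^ (1 - s))⁻¹) := by
  classical
  -- a uniformiser `|ϖ| = q⁻¹` (`q = residueFieldCard F = Nat.card 𝓀[F]` definitionally)
  obtain ⟨ϖ, -, hϖ⟩ := exists_normAbs_eq_inv (F := F)
  have hϖu : IsUniformizingElement ϖ := isUniformizingElement_of_normAbs_eq hϖ
  set q : ℕ := residueFieldCard F with hqdef
  have hqk : (Nat.card 𝓀[F] : ℂ) = (q : ℂ) := rfl
  have hq1 : 1 < q := one_lt_residueFieldCard F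
  have hq0 : 0 < q := lt_trans zero_lt_one hq1
  have hqC : (q : ℂ) ≠ 0 := Nat.cast_ne_zero.mpr hq0.ne'
  -- the variable `x = q^{-s}` and the disc `‖x‖ q < 1`
  set x : ℂ := (q : ℂ) ^ (-s) with hxdef
  have hxnorm : ‖x‖ = (q : ℝ) ^ (-s.re) := by rw [hxdef, Complex.norm_natCast_cpow_of_pos hq0, Complex.neg_re]
  have hxD : ‖x‖ * (q : ℝ) < 1 := by
    rw [hxnorm, Real.rpow_neg (Nat.cast_nonneg q), inv_mul_lt_iff₀ (Real.rpow_pos_of_pos (Nat.cast_pos.mpr hq0) _), mul_one]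
    calc (q : ℝ) = (q : ℝ) ^ (1 : ℝ) := (Real.rpow_one _).symm
      _ < (q : ℝ) ^ s.re := Real.rpow_lt_rpow_of_exponent_lt (by exact_mod_cast hq1) hs
  -- the coefficients `r_m = #(Δ_m K/K)` and the formal identity `(∑ r_m X^m)(1 − X)(1 − qX) = 1`
  set r : ℕ → ℂ := fun m => ((finite_cosets_glIntDet (n := 2) hϖu m).toFinset.card : ℂ) with hrdef
  set P : ℂ[X] := (1 - Polynomial.X) * (1 - Polynomial.C (q : ℂ) * Polynomial.X) with hPdef
  have hkey : PowerSeries.mk r * (P : PowerSeries ℂ) = 1 := by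
    rw [hPdef, ← hqk]; exact mk_card_cosets_glIntDet_two_mul_eq_one hϖu ℂ
  have hA : ∀ m, ‖r m‖ ≤ ((q : ℝ) / ((q : ℝ) - 1)) * (q : ℝ) ^ m := by
    intro m
    rw [hrdef, Complex.norm_natCast]
    have h := card_cosets_glIntDet_two_le hϖu m
    rwa [show (Nat.card 𝓀[F] : ℝ) = (q : ℝ) from rfl] at h
  have hval := tsum_eq_inv_eval_of_mk_mul_eq_one hkey (Nat.cast_nonneg q) hA hxD
  have heval : P.eval x = (1 - (q : ℂ) ^ (-s)) * (1 - (q : ℂ) ^ (1 - s)) := by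
    rw [hPdef, Polynomial.eval_mul, Polynomial.eval_sub, Polynomial.eval_sub, Polynomial.eval_one, Polynomial.eval_X, Polynomial.eval_mul,
      Polynomial.eval_C, Polynomial.eval_X, hxdef, sub_eq_add_neg 1 s, Complex.cpow_add _ _ hqC, Complex.cpow_one]
  -- the integrand, unfolded over the cosets in `M₂(𝒪)` (★ `setIntegral_isIntegralMatrix_eq`)
  set Fn : GL (Fin 2) F → ℂ := fun y => ((((normAbs F ((Matrix.GeneralLinearGroup.det y : Fˣ) : F)) : ℝ≥0) : ℝ) : ℂ) ^ s with hFndef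
  have hFK : ∀ y : GL (Fin 2) F, ∀ k ∈ glInt 2 F, Fn (y * k) = Fn y := by
    intro y k hk
    simp only [hFndef, map_mul, Units.val_mul, normAbs_det_eq_one_of_mem_glInt hk, mul_one]
  have hFval : ∀ m, ∀ γ ∈ (finite_cosets_glIntDet (n := 2) hϖu m).toFinset, Fn γ.out = x ^ m := by
    intro m γ hγ
    rw [Set.Finite.mem_toFinset, Set.mem_setOf_eq] at hγ
    simp only [hFndef]
    rw [normAbs_det_of_mem_glIntDet hγ, hϖ, hxdef, ← inv_natCast_pow_cpow]
    congr 1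
    push_cast
    rw [inv_pow]
  have hsumFn : Summable fun m : ℕ => ∑ γ ∈ (finite_cosets_glIntDet (n := 2) hϖu m).toFinset, ‖Fn γ.out‖ := by
    have hgeom : Summable fun m : ℕ => ((q : ℝ) / ((q : ℝ) - 1)) * (((q : ℝ)) * ‖x‖) ^ m :=
      (summable_geometric_of_lt_one (mul_nonneg (Nat.cast_nonneg q) (norm_nonneg x)) (by rwa [mul_comm])).mul_left _
    refine Summable.of_nonneg_of_le (fun m => Finset.sum_nonneg fun _ _ => norm_nonneg _) (fun m => ?_) hgeom
    calc ∑ γ ∈ (finite_cosets_glIntDet (n := 2) hϖu m).toFinset, ‖Fn γ.out‖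
        = ∑ _γ ∈ (finite_cosets_glIntDet (n := 2) hϖu m).toFinset, ‖x‖ ^ m := Finset.sum_congr rfl fun γ hγ => by rw [hFval m γ hγ, norm_pow]
      _ = (finite_cosets_glIntDet (n := 2) hϖu m).toFinset.card * ‖x‖ ^ m := by rw [Finset.sum_const, nsmul_eq_mul]
      _ ≤ (((q : ℝ) / ((q : ℝ) - 1)) * (q : ℝ) ^ m) * ‖x‖ ^ m := by
          refine mul_le_mul_of_nonneg_right ?_ (pow_nonneg (norm_nonneg x) m)
          have h := hA m; rwa [hrdef, Complex.norm_natCast] at h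
      _ = ((q : ℝ) / ((q : ℝ) - 1)) * ((q : ℝ) * ‖x‖) ^ m := by ring
  obtain ⟨hint, hhas⟩ := setIntegral_isIntegralMatrix_eq (E := ℂ) hϖu hμK hFK hsumFn
  -- the unfolded integral is `μ(K) · ∑ r_m x^m`
  have hhas' : HasSum (fun m : ℕ => (μG (glInt 2 F : Set (GL (Fin 2) F))).toReal * (r m * x ^ m))
      (∫ y in {y : GL (Fin 2) F | IsIntegralMatrix (y : Matrix (Fin 2) (Fin 2) F)}, Fn y ∂μG) := by
    have e : (fun m : ℕ => (μG (glInt 2 F)).toReal • ∑ γ ∈ (finite_cosets_glIntDet (n := 2) hϖu m).toFinset, Fn γ.out) =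
        fun m : ℕ => ((μG (glInt 2 F : Set (GL (Fin 2) F))).toReal : ℂ) * (r m * x ^ m) := by
      funext m
      rw [Complex.real_smul, hrdef, Finset.sum_congr rfl (hFval m), Finset.sum_const, nsmul_eq_mul]
    rw [e] at hhas
    exact_mod_cast hhas
  have hSm : MeasurableSet {y : GL (Fin 2) F | IsIntegralMatrix (y : Matrix (Fin 2) (Fin 2) F)} := by
    rw [setOf_isIntegralMatrix_eq_iUnion hϖu]
    refine MeasurableSet.iUnion fun m => ?_
    rw [setOf_mem_glIntDet_eq]
    exact (isOpen_setOf_mk_mem _).measurableSet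
  refine ⟨(integrable_indicator_iff hSm).mpr hint, ?_⟩
  rw [integral_indicator hSm, ← hhas'.tsum_eq, tsum_mul_left, hval, heval, hqk, mul_inv]

end Local

end Summit.HodgeConjecture.HodgeConjecture.Cruxes.H413.K2E5GL2UnramifiedLocalZeta

end
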